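import Summits.BirchSwinnertonDyer.Rank1Residual.Additive.KatoDescentKatoRigidDepletedValues
import HarnessLib

set_option autoImplicit false

/-!
# AUG engine, step 6: the identity (★χ) in AUG's OWN binders — Kato's guards `(c, 6pA) = 1`, `(d, 6pN) = 1`, `dd′ ≡ 1 (A)`
# imply the value-law guard `(cd, p^{n+1}A) = 1`; `IsNewformOf` gives the newform structure and `Ω⁺_f ≠ 0`
# (seat `bsd-cm-prr-ty1` g14, cell `bsd-cm`; theorems only: no definition, no named fact, no instance, no `sorry`)

Part 48 of the seat's kernel cut of stub 3 (cruxes stmt-BirchSwinnertonDyer-19945 / -19223).  E33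
`aeval_mul_explicitValues_eq_of_smul_eq_smul` is stated with the value-law guards of `ZetaBody` (C5)
(`Int.gcd (cᵢ dᵢ) (p^{n+1} Aᵢ) = 1`, `dᵢ d′ᵢ ≡ 1 (Aᵢ)`), a newform structure `IsNewform0 f`, `Aᵢ ≠ 0` and `Ω⁺_f ≠ 0`.  The display
AUG (E28 `katoRigid_of_thm12_4_of_aug`) carries instead the binders of KATO-RIGID: `IsNewformOf W f`, `0 < Aᵢ`,
`Int.gcd cᵢ (6pAᵢ) = 1`, `Int.gcd dᵢ (6pN) = 1`, `dᵢ d′ᵢ ≡ 1 (Aᵢ)`, the proportionality `Λ₂ = e • Λ₁` on ALL pure levels and the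
projection hypotheses at ALL layers.  THIS FILE derives the former from the latter and restates (★χ) in AUG's binders, so that the
successor's ENDGAME (HOME `bsd-cm-prr-ty1/STUB3-CUT.md` §6 addendum 7) starts from exactly the data AUG quantifies over:
* `isCoprime_of_mul_modEq_one` (`dd′ ≡ 1 (A) ⇒ (d, A) = 1`), `gcd_mul_cycLevel_mul_eq_one` (Kato's guards ⇒ `(cd, p^k·A) = 1`);
* ★ `aeval_mul_explicitValues_eq_of_augData` — for AUG's data, every layer `n`, every collinearity `F • y₁ = G • y₂` with
  representatives `r_F ≡ F`, `r_G ≡ G (mod ω_n)`, every even character `χ` of `Gal(ℚ_n/ℚ)` mod `p^{n+1}`, every continuation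
  `L₀` of its mod-`p^{n+1}` twisted series with `L₀(1) ≠ 0`, every `χ`-component functional `ev` at the frame `ι₁(p^{n+1})`
  and every frame rotation `ι₂ ∘ σ_a = ι₁`:
  **`r_F(u − 1)·(e • (1 ⊗ q₁·P₁(χ,1)·𝒸⁻_χ̄(π₁))) = r_G(u − 1)·(1 ⊗ χ⁻¹(a)·(q₂·P₂(χ,1)·𝒸⁻_χ̄(π₂)))`** in `ℚ_p ⊗_ℚ ℂ`.
HONEST LABEL: theorems about the tree's readings; AUG stays displayed (this is NOT AUG: AUG's conclusion is the trivial-character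
constant-term identity, reached from (★χ) only through the successor's separation argument); no stub closed; nothing asserted on
19945 / 19223; BSD is not proved for any curve.
References: [Kato2004Asterisque] Ex. 13.3 / (13.1.1) (pp. 224–225: the guards), §13.9 (p. 230), Thm. 6.6 (1) (p. 163), Thm. 9.7 (p. 189).
-/

noncomputable section

open scoped BigOperators NumberField TensorProduct
open Polynomial Field IsDedekindDomain CongruenceSubgroup
open Literature.NumberTheory.GaloisRepresentations
open Literature.NumberTheory.EllipticCurves Literature.NumberTheory.EllipticCurves.ModularForms
open Literature.NumberTheory.EllipticCurves.Kato2004 Literature.NumberTheory.EllipticCurves.Kato2004.EulerSystemValues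
open Rat.HeightOneSpectrum
open Summit.BirchSwinnertonDyer.Rank1Residual.GaloisImage

namespace Summit.BirchSwinnertonDyer.Rank1Residual.Additive.PerrinRiouUnit

/-! ## §1 Kato's guards imply the value-law guard -/

section Guards

/-- `d d′ ≡ 1 (mod A)` makes `d` and `A` coprime. [folklore] -/
theorem isCoprime_of_mul_modEq_one {d d' : ℤ} {A : ℕ} (h : d * d' ≡ 1 [ZMOD (A : ℤ)]) : IsCoprime d (A : ℤ) := by
  obtain ⟨k, hk⟩ := h.dvd
  exact ⟨d', k, by linear_combination (-1 : ℤ) * hk⟩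

/-- **Kato's guards `(c, 6pA) = 1`, `(d, 6pN) = 1`, `dd′ ≡ 1 (A)` imply the value-law guard `(cd, p^k·A) = 1`** at every pure
`p`-power level `m = p^k` (`cycLevel p k ∅ = p^k`). [cite: Kato2004Asterisque, Ex. 13.3 (p. 225) and (8.1.2) (p. 180)] -/
theorem gcd_mul_cycLevel_mul_eq_one {p : ℕ} {N A : ℕ} {c d d' : ℤ} (hc : Int.gcd c (6 * p * A) = 1)
    (hd : Int.gcd d (6 * p * N) = 1) (hdd' : d * d' ≡ 1 [ZMOD (A : ℤ)]) (k : ℕ) :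
    Int.gcd (c * d) (cycLevel p k ∅ * A) = 1 := by
  rw [← Int.isCoprime_iff_gcd_eq_one] at hc hd ⊢
  have hcp : IsCoprime c (p : ℤ) := hc.of_mul_right_left.of_mul_right_right
  have hcA : IsCoprime c (A : ℤ) := hc.of_mul_right_right
  have hdp : IsCoprime d (p : ℤ) := hd.of_mul_right_left.of_mul_right_right
  have hdA : IsCoprime d (A : ℤ) := isCoprime_of_mul_modEq_one hdd'
  unfold cycLevel
  rw [Finset.prod_empty, mul_one]
  push_cast
  exact ((hcp.mul_left hdp).pow_right).mul_right (hcA.mul_left hdA)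

end Guards

/-! ## §2 (★χ) in AUG's binders -/

section Values

variable {W : WeierstrassCurve ℚ} [W.IsElliptic] {p : ℕ} [Fact p.Prime] [ContinuousSMul ℤ_[p] (W.tateModule p)]
  [Module.Free ℤ_[p] (W.tateModule p)] [Module.Finite ℤ_[p] (W.tateModule p)]
  {N : ℕ} [NeZero N] {f : CuspForm (Gamma0 N) 2} {ι₁ ι₂ : (m : ℕ) → (CyclotomicField m ℚ →+* ℂ)} {q₁ q₂ : ℚ}
  {Λ₁ Λ₂ : ∀ (k : ℕ) (r : Finset (HeightOneSpectrum (𝓞 ℚ))),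
    H1 (tateRep W p) (cycSubgroup p k r) →ₗ[ℤ_[p]] ℚ_[p] ⊗[ℚ] CyclotomicField (cycLevel p k r) ℚ}
  {c₁ d₁ a₁ : ℤ} {A₁ : ℕ} {d'₁ : ℤ} {c₂ d₂ a₂ : ℤ} {A₂ : ℕ} {d'₂ : ℤ}
  {z₁ : ∀ (k : ℕ) (r : (cyclotomicLevelsRat p (badPlaces c₁ d₁ A₁ N)).Ideals),
    H1 (tateRep W p) ((cyclotomicLevelsRat p (badPlaces c₁ d₁ A₁ N)).level k r.1)}
  {x₁ : ∀ (k : ℕ) (r : (cyclotomicLevelsRat p (badPlaces c₁ d₁ A₁ N)).Ideals), CyclotomicField (cycLevel p k r.1) ℚ}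
  {z₂ : ∀ (k : ℕ) (r : (cyclotomicLevelsRat p (badPlaces c₂ d₂ A₂ N)).Ideals),
    H1 (tateRep W p) ((cyclotomicLevelsRat p (badPlaces c₂ d₂ A₂ N)).level k r.1)}
  {x₂ : ∀ (k : ℕ) (r : (cyclotomicLevelsRat p (badPlaces c₂ d₂ A₂ N)).Ideals), CyclotomicField (cycLevel p k r.1) ℚ}
  {K : ZpExtension ℚ p} {γ : absoluteGaloisGroup ℚ}

/-- **(★χ) for AUG's data.**  In the binders of the display AUG (E28; Kato's guards, `IsNewformOf`, `Λ₂ = e • Λ₁` on all pure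
levels, projections at all layers): for every layer `n`, collinearity `F • y₁ = G • y₂` with representatives mod `ω_n`, even
character `χ` of `Gal(ℚ_n/ℚ)` mod `p^{n+1}` whose mod-`p^{n+1}` twisted series has a continuation `L₀` with `L₀(1) ≠ 0`,
`χ`-component functional `ev` at `ι₁(p^{n+1})` and frame rotation `ι₂ ∘ σ_a = ι₁`:
`r_F(u − 1)·(e • (1 ⊗ q₁·P₁(χ,1)·𝒸⁻_χ̄(π₁))) = r_G(u − 1)·(1 ⊗ χ⁻¹(a)·(q₂·P₂(χ,1)·𝒸⁻_χ̄(π₂)))` in `ℚ_p ⊗_ℚ ℂ`.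
[cite: Kato2004Asterisque, §13.9 (p. 230), Thm. 6.6 (1) (p. 163), Thm. 9.7 (p. 189), §6.2 (p. 161)] -/
theorem aeval_mul_explicitValues_eq_of_augData (hp : p ≠ 2) (hnf : IsNewformOf W f) {e : ℚ_[p]}
    (hΛ : ∀ (k : ℕ) (y : H1 (tateRep W p) (cycSubgroup p k ∅)), Λ₂ k ∅ y = e • Λ₁ k ∅ y)
    (hA₁ : 0 < A₁) (hc₁ : Int.gcd c₁ (6 * p * A₁) = 1) (hd₁ : Int.gcd d₁ (6 * p * N) = 1)
    (hdd₁ : (d₁ : ℤ) * d'₁ ≡ 1 [ZMOD (A₁ : ℤ)])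
    (hA₂ : 0 < A₂) (hc₂ : Int.gcd c₂ (6 * p * A₂) = 1) (hd₂ : Int.gcd d₂ (6 * p * N) = 1)
    (hdd₂ : (d₂ : ℤ) * d'₂ ≡ 1 [ZMOD (A₂ : ℤ)])
    (hb₁ : ZetaBody W p f ι₁ ((q₁ : ℚ) : ℝ) Λ₁ c₁ d₁ a₁ A₁ z₁ x₁) (hb₂ : ZetaBody W p f ι₂ ((q₂ : ℚ) : ℝ) Λ₂ c₂ d₂ a₂ A₂ z₂ x₂)
    (hK : K.IsCyclotomic) (hγ : K.IsTopGenerator γ) (I : IwasawaH1Data W p K γ) {y₁ y₂ : I.H}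
    (hy₁ : ∀ n : ℕ, I.proj n y₁ = levelToLayer W p hK hp (badPlaces c₁ d₁ A₁ N) n
      (z₁ (n + 1) (cyclotomicLevelsRat p (badPlaces c₁ d₁ A₁ N)).idealOne))
    (hy₂ : ∀ n : ℕ, I.proj n y₂ = levelToLayer W p hK hp (badPlaces c₂ d₂ A₂ N) n
      (z₂ (n + 1) (cyclotomicLevelsRat p (badPlaces c₂ d₂ A₂ N)).idealOne))
    {F G : IwasawaAlgebra p} (hFG : F • y₁ = G • y₂) (n : ℕ) {rF rG : ℤ_[p][X]}
    (hF : F - (rF : PowerSeries ℤ_[p]) ∈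
      Ideal.span {(((Polynomial.X + 1 : ℤ_[p][X]) ^ p ^ n - 1 : ℤ_[p][X]) : PowerSeries ℤ_[p])})
    (hG : G - (rG : PowerSeries ℤ_[p]) ∈
      Ideal.span {(((Polynomial.X + 1 : ℤ_[p][X]) ^ p ^ n - 1 : ℤ_[p][X]) : PowerSeries ℤ_[p])})
    (χ : DirichletCharacter ℂ (cycLevel p (n + 1) ∅))
    (hχ : ∀ σ ∈ K.layerSubgroup n,
      χ ((modNCyclotomicCharacter ℚ (cycLevel p (n + 1) ∅) σ : (ZMod (cycLevel p (n + 1) ∅))ˣ) :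
        ZMod (cycLevel p (n + 1) ∅)) = 1)
    (heven : χ (-1) = 1)
    {ev : ℚ_[p] ⊗[ℚ] CyclotomicField (cycLevel p (n + 1) ∅) ℚ →ₗ[ℚ_[p]] ℚ_[p] ⊗[ℚ] ℂ}
    (hev : ∀ (s : ℚ_[p]) (x : CyclotomicField (cycLevel p (n + 1) ∅) ℚ),
      ev (s ⊗ₜ[ℚ] x) = s ⊗ₜ[ℚ] charSum (cycLevel p (n + 1) ∅) (ι₁ (cycLevel p (n + 1) ∅)) χ x)
    {a : (ZMod (cycLevel p (n + 1) ∅))ˣ}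
    (ha : ∀ y, ι₂ (cycLevel p (n + 1) ∅) (sigma (cycLevel p (n + 1) ∅) a y) = ι₁ (cycLevel p (n + 1) ∅) y)
    {L₀ : ℂ → ℂ} (hd : Differentiable ℂ L₀)
    (hs : ∀ s : ℂ, 2 < s.re → L₀ s = twistedLSeries f χ s) (hL : L₀ 1 ≠ 0) :
    aeval (((1 : ℚ_[p]) ⊗ₜ[ℚ] χ⁻¹ ((modNCyclotomicCharacter ℚ (cycLevel p (n + 1) ∅) γ : (ZMod (cycLevel p (n + 1) ∅))ˣ) :
        ZMod (cycLevel p (n + 1) ∅)) : ℚ_[p] ⊗[ℚ] ℂ) - 1) rF *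
        (e • ((1 : ℚ_[p]) ⊗ₜ[ℚ] ((((q₁ : ℚ) : ℝ) : ℂ) *
          (∏ ℓ ∈ (cycLevel p (n + 1) ∅ * (p * A₁)).primeFactors.filter (fun ℓ => ¬ ℓ ∣ cycLevel p (n + 1) ∅),
              (1 - χ (ℓ : ZMod (cycLevel p (n + 1) ∅)) * cuspCoeff f ℓ * (ℓ : ℂ) ^ (-(1 : ℂ)) +
                (if ℓ ∣ N then 0 else (ℓ : ℂ)) * χ (ℓ : ZMod (cycLevel p (n + 1) ∅)) ^ 2 * ((ℓ : ℂ) ^ (-(1 : ℂ))) ^ 2)) *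
          cuspFactor f true (fun k ↦ χ⁻¹ (k : ZMod (cycLevel p (n + 1) ∅))) c₁ d₁ a₁ A₁ d'₁))) =
      aeval (((1 : ℚ_[p]) ⊗ₜ[ℚ] χ⁻¹ ((modNCyclotomicCharacter ℚ (cycLevel p (n + 1) ∅) γ : (ZMod (cycLevel p (n + 1) ∅))ˣ) :
        ZMod (cycLevel p (n + 1) ∅)) : ℚ_[p] ⊗[ℚ] ℂ) - 1) rG *
        ((1 : ℚ_[p]) ⊗ₜ[ℚ] (χ⁻¹ (a : ZMod (cycLevel p (n + 1) ∅)) * ((((q₂ : ℚ) : ℝ) : ℂ) *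
          (∏ ℓ ∈ (cycLevel p (n + 1) ∅ * (p * A₂)).primeFactors.filter (fun ℓ => ¬ ℓ ∣ cycLevel p (n + 1) ∅),
              (1 - χ (ℓ : ZMod (cycLevel p (n + 1) ∅)) * cuspCoeff f ℓ * (ℓ : ℂ) ^ (-(1 : ℂ)) +
                (if ℓ ∣ N then 0 else (ℓ : ℂ)) * χ (ℓ : ZMod (cycLevel p (n + 1) ∅)) ^ 2 * ((ℓ : ℂ) ^ (-(1 : ℂ))) ^ 2)) *
          cuspFactor f true (fun k ↦ χ⁻¹ (k : ZMod (cycLevel p (n + 1) ∅))) c₂ d₂ a₂ A₂ d'₂))) :=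
  aeval_mul_explicitValues_eq_of_smul_eq_smul hb₁ hb₂ hnf.1 hA₁.ne' hA₂.ne' hK hp hγ I n (hy₁ n) (hy₂ n) (hΛ (n + 1))
    hF hG hFG χ hχ heven hev ha d'₁ d'₂ (gcd_mul_cycLevel_mul_eq_one hc₁ hd₁ hdd₁ (n + 1)) hdd₁
    (gcd_mul_cycLevel_mul_eq_one hc₂ hd₂ hdd₂ (n + 1)) hdd₂ hd hs hL
    (IsNewform0.plusPeriod_pos_holds hnf.1 hnf.coeffField_eq_bot).ne'

end Values

end Summit.BirchSwinnertonDyer.Rank1Residual.Additive.PerrinRiouUnit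

end
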